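import Summits.Ventures.AbcSig.Rows.TemplateC2a
import Summits.Ventures.AbcSig.Levels.N298
import Summits.Ventures.AbcSig.Levels.N4768

/-!
# Venture AbcSig — ROW `C2aL149A3`: `xⁿ + 2^a·149^m·yⁿ = z²`, class `a 3` (GENERATED by plean/leanrow.py)

HONEST FRAMING. A row of a COMPUTATION cell (`pub-abcsig`); a CONDITIONAL theorem, no claim on ABC or any summit.
Hypotheses: `BS04Package` (CITED), `DataComplete` at levels [298, 4768] (COMPUTED, two-engine certified
level files), and the listed per-orbit exclusions `hX_…` (CITED; the
row's R5 cell names each). Everything else is kernel-checked (`Rows/TemplateC2a.lean`, `Levels/N….lean`). Exponent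
range: prime `n ≥ 11`, `n ≠ 149`; `B = 2^a 149^m` with `a, m < n` (n-th-power free).
Row of record: `census/rows/C2a/C2a-l149-a3.md` (sha256 `5101d94d50e52852…`; SIGNED 2026-08-22T17:51:55Z by referee (ref-g14)); its R0: THEOREM (uses CITED arithmetic facts) for all primes n >= 11 with n coprime to 1192 — class: candidate (a ∈ {0,3} cell, BATCH-03; lit/COVERAGE §C2 + I–K 2006 Th. Exponents left open by the row of record are excluded here via `hres`; kernel-sieve residuals the row of record closes by a cell module (M6 Eisenstein / M4 Kraus certificates) appear as CITED hypotheses `hX_…`.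
-/

namespace Summit.Ventures.AbcSig

/-- Row `C2aL149A3` (see module docstring). -/
theorem row_C2aL149A3 (M : NewformModel) (hP : M.BS04Package)
    (hD298 : M.DataComplete 298 level298Orbits) (hD4768 : M.DataComplete 4768 level4768Orbits)
    (n : ℕ) (hn : n.Prime) (hmin : 11 ≤ n) (hnℓ : n ≠ 149) (m : ℕ) (hm : 1 ≤ m) (hmn : m < n)
    (hX_orbit_298_2 : n ∈ ([7, 11] : List ℕ) → M.Excludes 298 orbit_298_2 (famB (2 ^ 3 * 149 ^ m) n (fun _ _ => True)))
    (hX_orbit_4768_3 : n ∈ ([17] : List ℕ) → M.Excludes 4768 orbit_4768_3 (famB (2 ^ 3 * 149 ^ m) n (fun _ _ => True)))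
    (hX_orbit_4768_8 : n ∈ ([7, 41] : List ℕ) → M.Excludes 4768 orbit_4768_8 (famB (2 ^ 3 * 149 ^ m) n (fun _ _ => True)))
    (x y z : ℤ) (hxy1 : x * y ≠ 1) (hxy2 : x * y ≠ -1) : ¬ IsPrimitiveSolution 1 (2 ^ 3 * 149 ^ m) 1 n x y z := by
  have hℓ : Nat.Prime 149 := by norm_num
  have h7 : 7 ≤ n := by omega
  have hS298 :=
    (level298_sieve n hn h7 (fun o => M.Excludes 298 o (famB (2 ^ 3 * 149 ^ m) n (fun _ _ => True))) (fun h => absurd h (by simp only [List.mem_cons, List.not_mem_nil, or_false]; omega)) hX_orbit_298_2 (fun h => absurd h (by simp only [List.mem_cons, List.not_mem_nil, or_false]; omega)))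
  have hS4768 :=
    (level4768_sieve n hn h7 (fun o => M.Excludes 4768 o (famB (2 ^ 3 * 149 ^ m) n (fun _ _ => True))) (fun h => absurd h (by simp only [List.mem_cons, List.not_mem_nil, or_false]; omega)) (fun h => absurd h (by simp only [List.mem_cons, List.not_mem_nil, or_false]; omega)) hX_orbit_4768_3 hX_orbit_4768_8 (fun h => absurd h (by simp only [List.mem_cons, List.not_mem_nil, or_false]; omega)) (fun h => absurd h (by simp only [List.mem_cons, List.not_mem_nil, or_false]; omega)))
  exact rowC2a_a3 149 hℓ (by norm_num) M hP n hn h7 hnℓ hD4768 hD298 m hm hmn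
    hS4768
    hS298 x y z hxy1 hxy2

end Summit.Ventures.AbcSig
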